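import Literature.Analysis.FluidPDE.BradshawTsaiDSSExistenceHolds
import Literature.Analysis.FluidPDE.AncientWeakL3BackwardLiouvilleAssembly
import Literature.Analysis.FluidPDE.SelfSimilar
import HarnessLib

/-!
# The scar is admissible forward-DSS data — crux stmt-NavierStokesRegularity-1404
  (`QuantisedSymmetry.PolyhedralDssProfileExists`), line polyhedral_cell,
  stub stub_scarForwardDss (N32)

Registered stub `stub_scarForwardDss` (`--supports stmt-NavierStokesRegularity-1404`). The
blow-up-time trace ("scar") `V₀` of a witness is measurable, weakly divergence free, obeys the
critical envelope `|x| |V₀(x)| ≤ C₀` and is `(-1)`-DSS-homogeneous, `V₀(c x) = c⁻¹ V₀(x)` (`c > 1`).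
Such a field is an admissible datum for Bradshaw–Tsai's forward theory ([BT1] = Ann. Henri
Poincaré 18 (2017), Thm 1.2, the TREE THEOREM `bradshawTsai2017_dss_localLeray_existence_holds`),
so the blow-up continues past the singular time as a forward `c`-DSS local Leray solution.

Proof sketch.
* weak-`L³`: for `σ > 0` the superlevel set `{σ < |V₀|}` lies in the closed ball of radius `C₀/σ`
  (`σ |x| ≤ |x| |V₀ x| ≤ C₀`), so `σ³ |{σ < |V₀|}| ≤ C₀³ |B₁| < ∞`; then
  `memWeakLp_three_of_forall`.
* `c`-DSS datum: `nsRescaleData c V₀ x = c • V₀ (c • x) = c • c⁻¹ • V₀ x = V₀ x`.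
* Apply `bradshawTsai2017_dss_localLeray_existence_holds`.
-/

noncomputable section

-- the summit namespace `…NavierStokesRegularity.NavierStokesRegularity…` is the tree convention (D-0017)
set_option linter.dupNamespace false

namespace Summit.NavierStokesRegularity.NavierStokesRegularity.Theorems.PolyhedralDssProfileExists.PolyhedralCell

open MeasureTheory Set Function Filter Topology Metric
open Literature.Analysis Literature.Analysis.FluidPDE
open scoped ENNReal

/-! ### The critical envelope `|x| |V₀ x| ≤ C₀` gives weak-`L³` -/

/-- **Superlevel sets under the critical envelope.** If `‖x‖ ‖f x‖ ≤ C₀` everywhere, then for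
`σ > 0` the superlevel set `{σ < ‖f‖}` lies in the closed ball `closedBall 0 (C₀/σ)`:
`σ ‖x‖ ≤ ‖x‖ ‖f x‖ ≤ C₀`. [folklore] -/
theorem scarForwardDss_superlevel_subset
    {f : EuclideanSpace ℝ (Fin 3) → EuclideanSpace ℝ (Fin 3)} {C₀ : ℝ}
    (henv : ∀ x, ‖x‖ * ‖f x‖ ≤ C₀) {σ : ℝ} (hσ : 0 < σ) :
    {x : EuclideanSpace ℝ (Fin 3) | σ < ‖f x‖} ⊆ closedBall 0 (C₀ / σ) := fun x hx => by
  rw [mem_closedBall_zero_iff, le_div_iff₀ hσ]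
  calc ‖x‖ * σ ≤ ‖x‖ * ‖f x‖ := mul_le_mul_of_nonneg_left (le_of_lt hx) (norm_nonneg x)
    _ ≤ C₀ := henv x

/-- **Weak-`L³` bound under the critical envelope.** If `‖x‖ ‖f x‖ ≤ C₀` everywhere, then
`σ³ |{σ < ‖f‖}| ≤ C₀³ |B₁|` for every `σ > 0` (the superlevel set lies in the ball of radius
`C₀/σ`, whose volume is `(C₀/σ)³ |B₁|`). [folklore] -/
theorem scarForwardDss_weakL3_bound
    {f : EuclideanSpace ℝ (Fin 3) → EuclideanSpace ℝ (Fin 3)} {C₀ : ℝ}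
    (henv : ∀ x, ‖x‖ * ‖f x‖ ≤ C₀) {σ : ℝ} (hσ : 0 < σ) :
    ENNReal.ofReal σ ^ 3 * volume {x : EuclideanSpace ℝ (Fin 3) | σ < ‖f x‖} ≤
      ENNReal.ofReal (C₀ ^ 3) * volume (ball (0 : EuclideanSpace ℝ (Fin 3)) 1) := by
  have hC₀ : 0 ≤ C₀ := by simpa using henv 0
  calc ENNReal.ofReal σ ^ 3 * volume {x : EuclideanSpace ℝ (Fin 3) | σ < ‖f x‖}
      ≤ ENNReal.ofReal σ ^ 3 *
          volume (closedBall (0 : EuclideanSpace ℝ (Fin 3)) (C₀ / σ)) := by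
        gcongr
        exact scarForwardDss_superlevel_subset henv hσ
    _ = ENNReal.ofReal (C₀ ^ 3) * volume (ball (0 : EuclideanSpace ℝ (Fin 3)) 1) := by
        rw [Measure.addHaar_closedBall volume _ (by positivity : (0 : ℝ) ≤ C₀ / σ),
          finrank_euclideanSpace_fin, ← mul_assoc, ← ENNReal.ofReal_pow hσ.le,
          ← ENNReal.ofReal_mul (by positivity), ← mul_pow, mul_div_cancel₀ _ hσ.ne']

/-- **The scar is a weak-`L³` field.** A measurable field under the critical envelope
`‖x‖ ‖f x‖ ≤ C₀` belongs to `L³_w(ℝ³)`. [folklore] -/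
theorem scarForwardDss_memWeakLp
    {f : EuclideanSpace ℝ (Fin 3) → EuclideanSpace ℝ (Fin 3)} {C₀ : ℝ}
    (hf : AEStronglyMeasurable f volume) (henv : ∀ x, ‖x‖ * ‖f x‖ ≤ C₀) :
    FunctionSpaces.MemWeakLp f 3 volume :=
  memWeakLp_three_of_forall hf
    (ENNReal.mul_lt_top ENNReal.ofReal_lt_top measure_ball_lt_top)
    (fun _ hσ => scarForwardDss_weakL3_bound henv hσ)

/-- **`(-1)`-homogeneity under `x ↦ c x` is invariance of the datum under the Navier–Stokes
scaling.** If `f (c • x) = c⁻¹ • f x` for all `x` (`c ≠ 0`), then `nsRescaleData c f = f`.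
[folklore] -/
theorem scarForwardDss_nsRescaleData_eq
    {f : EuclideanSpace ℝ (Fin 3) → EuclideanSpace ℝ (Fin 3)} {c : ℝ} (hc : c ≠ 0)
    (hhom : ∀ x, f (c • x) = c⁻¹ • f x) : nsRescaleData c f = f := by
  funext x
  rw [nsRescaleData_apply, hhom x, smul_smul, mul_inv_cancel₀ hc, one_smul]

/-! ### The stub -/

/-- **Stub N32: the scar continues as a forward `c`-DSS local Leray solution.** A measurable,
weakly divergence free field `V₀` on `ℝ³` with `‖x‖ ‖V₀ x‖ ≤ C₀` and `V₀ (c x) = c⁻¹ V₀ x`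
(`c > 1`) is a divergence free `c`-DSS datum in `L³_w(ℝ³)`, hence (Bradshaw–Tsai, Ann. Henri
Poincaré 18 (2017), Thm 1.2 — the tree theorem
`bradshawTsai2017_dss_localLeray_existence_holds`) the datum of a forward `c`-DSS local Leray
solution `(v, π)` of Navier–Stokes with viscosity `1`. [cite: BradshawTsai2017AHP, Thm 1.2] -/
theorem stub_scarForwardDss :
    ∀ (V₀ : EuclideanSpace ℝ (Fin 3) → EuclideanSpace ℝ (Fin 3)) (C₀ c : ℝ),
      AEStronglyMeasurable V₀ volume → IsWeaklyDivFree V₀ → (∀ x, ‖x‖ * ‖V₀ x‖ ≤ C₀) →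
      1 < c → (∀ x, V₀ (c • x) = c⁻¹ • V₀ x) →
      ∃ (v : ℝ → EuclideanSpace ℝ (Fin 3) → EuclideanSpace ℝ (Fin 3)) (π : ℝ → EuclideanSpace ℝ (Fin 3) → ℝ),
        IsLocalLeraySolution 1 V₀ v π ∧ IsDiscretelySelfSimilar c v := by
  intro V₀ C₀ c hmeas hdiv henv hc hhom
  exact bradshawTsai2017_dss_localLeray_existence_holds hc (scarForwardDss_memWeakLp hmeas henv) hdiv
    (scarForwardDss_nsRescaleData_eq (by positivity) hhom)

end Summit.NavierStokesRegularity.NavierStokesRegularity.Theorems.PolyhedralDssProfileExists.PolyhedralCell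

end
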